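import Literature.NumberTheory.LFunctions.ConreyIwaniec2002KernelMellin
import Literature.NumberTheory.LFunctions.DirichletPolynomialGallagher
import HarnessLib

/-!
# Conrey–Iwaniec (2002), Theorem 6.1, (6.4)–(6.6): the identity `𝒜(T) = L(0)TG + 2T Re Σ_{h>0} S(h)`

B. Conrey, H. Iwaniec, *Spacing of zeros of Hecke `L`-functions and the class number problem*,
Acta Arith. 103 (2002) 259–312, §6 [held text `paper:arxiv-math_0111012`, p0014:L40–L75]:
"We get `𝒜(T) = T Σ_m Σ_n a_m ā_n L(T log(m/n))` … we arrange this double sum according to the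
difference `m − n = h` … `S(h) = Σ_{m−n=h} a_m ā_n L(T log(m/n))` (6.4). Note that `S(−h) = \overline{S(h)}`
so we have `𝒜(T) = L(0)TG + 2T Re Σ_{h>0} S(h)` (6.5) … `L(0) = 2∫₀^∞ K(u)du` (6.6)."

PROVED HERE (namespace `ConreyIwaniec2002.Thm61GenericPart`; first of four files towards the
registered sub-stub S2a `stub_thm61_generic` of SKELETON P64, line `thm61-cm-convolution`, cell
landau-siegel/ls-inputs; interface `ConreyIwaniec2002.Thm61Generic` of
`ConreyIwaniec2002MeanValueDefs.lean`), for an admissible kernel `K` (`IsCIKernel K`, `L = ciL K`)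
and a sequence `a : ℕ → ℂ` with `a 0 = 0`, `G₂ = Σ n²|a_n|² < ∞`, `T > 0`:
* `summable_norm`, `summable_norm_sq`, `summable_mul_norm_sq`: `Σ|a_n|, G, G₁ < ∞`;
* `LSeries_eq_tsum_phase`, `ofReal_norm_sq_LSeries`: `|A(it)|² = Σ_{(m,n)} a_m m^{-it} conj(a_n n^{-it})`;
* `integral_kernel_phase`: `∫ K(t/T)e^{−itθ}dt = T·L(Tθ)` (substitution + the tree's
  `KernelMellin.fourier_kernel_eq`, `𝓕K(ξ) = L(2πξ)`);
* `integral_kernel_normSq_eq`: `∫K(t/T)|A(it)|²dt = T Σ_{(m,n)} a_m ā_n L(T(log m − log n))`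
  (termwise integration of the absolutely convergent double series against the integrable `K(t/T)`);
* `tsum_prod_split`: `ℕ × ℕ = diagonal ⊔ {m > n} ⊔ {m < n}` for norm-summable families;
* `integral_kernel_normSq_eq_diag_add_offdiag` — **(6.5)–(6.6)**:
  `∫K(t/T)|A(it)|²dt = L(0)·T·Σ|a_n|² + 2T·Re U`, `U = Σ_{h,n ≥ 1} a_{n+h} ā_n L(T log((n+h)/n))`
  written over `(h−1, n−1) ∈ ℕ × ℕ` (the lower triangle is the conjugate of the upper one since `L`
  is real and even).

«The programme SEARCHES and TYPES; no claim about Landau–Siegel zeros, Theorems 1–2 of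
arXiv:2211.02515 or a repaired Margin232 until a kernel theorem says so.»

## References
* [ConreyIwaniec2002] B. Conrey, H. Iwaniec, *Spacing of zeros of Hecke L-functions and the class
  number problem*, Acta Arith. 103 (2002) 259–312, arXiv:math/0111012: §5 (5.14)–(5.18), §6 (6.1)–(6.12).
-/

noncomputable section

open Complex MeasureTheory Set Filter Real Finset
open scoped ComplexConjugate FourierTransform

namespace Literature.NumberTheory.LFunctions

namespace ConreyIwaniec2002

namespace Thm61GenericPart

open Gallagher (phase norm_phase continuous_phase natCast_cpow_eq_phase)
open KernelMellin (fourier_kernel_eq abs_ciL_le ciL_even)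

/-! ### Summability of the coefficient sequence from `G₂ < ∞` -/

section Coeff

variable {a : ℕ → ℂ} (ha0 : a 0 = 0) (hG : Summable fun n : ℕ => (n : ℝ) ^ 2 * ‖a n‖ ^ 2)
include ha0 hG

/-- `Σ |a_n| < ∞` (from `Σ n²|a_n|² < ∞` by `2|a_n| ≤ n²|a_n|² + n⁻²`).
[cite: ConreyIwaniec2002, §6 (6.11)] -/
theorem summable_norm : Summable fun n : ℕ => ‖a n‖ := by
  have h2 : Summable fun n : ℕ => ((n : ℝ) ^ 2)⁻¹ := Real.summable_nat_pow_inv.mpr one_lt_two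
  refine Summable.of_nonneg_of_le (fun n => norm_nonneg _) (fun n => ?_) ((hG.add h2).div_const 2)
  rcases Nat.eq_zero_or_pos n with rfl | hn
  · simp [ha0]
  · have hn' : (0:ℝ) < n := by exact_mod_cast hn
    have key : 2 * ((n : ℝ) * ‖a n‖) * (n : ℝ)⁻¹ = 2 * ‖a n‖ := by field_simp
    have := two_mul_le_add_sq ((n : ℝ) * ‖a n‖) ((n : ℝ)⁻¹)
    rw [mul_pow, inv_pow, key] at this
    linarith

/-- `G = Σ |a_n|² < ∞`. [cite: ConreyIwaniec2002, §5 (5.16), §6 (6.11)] -/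
theorem summable_norm_sq : Summable fun n : ℕ => ‖a n‖ ^ 2 := by
  refine Summable.of_nonneg_of_le (fun n => by positivity) (fun n => ?_) hG
  rcases Nat.eq_zero_or_pos n with rfl | hn
  · simp [ha0]
  · have hn' : (1:ℝ) ≤ n := by exact_mod_cast hn
    have : (1:ℝ) ≤ (n:ℝ) ^ 2 := one_le_pow₀ hn'
    nlinarith [sq_nonneg ‖a n‖]

/-- `G₁ = Σ n|a_n|² < ∞`. [cite: ConreyIwaniec2002, §5 (5.14), §6 (6.11)] -/
theorem summable_mul_norm_sq : Summable fun n : ℕ => (n : ℝ) * ‖a n‖ ^ 2 := by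
  refine Summable.of_nonneg_of_le (fun n => by positivity) (fun n => ?_) hG
  rcases Nat.eq_zero_or_pos n with rfl | hn
  · simp [ha0]
  · have hn' : (1:ℝ) ≤ n := by exact_mod_cast hn
    have : (n:ℝ) ≤ (n:ℝ) ^ 2 := by nlinarith
    nlinarith [sq_nonneg ‖a n‖]

end Coeff

/-! ### The Dirichlet series on the imaginary axis -/

section Series

variable {a : ℕ → ℂ} (ha0 : a 0 = 0) (hG : Summable fun n : ℕ => (n : ℝ) ^ 2 * ‖a n‖ ^ 2)
include ha0

/-- `A(it) = Σ_n a_n n^{-it}` with the phases `n^{-it} = e^{-it log n}` (`a₀ = 0`).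
[cite: ConreyIwaniec2002, §5 (5.1), §6 (6.4)] -/
theorem LSeries_eq_tsum_phase (t : ℝ) : LSeries a (t * I) = ∑' n : ℕ, a n * phase n t := by
  unfold LSeries
  refine tsum_congr fun n => ?_
  rw [LSeries.term_def₀ ha0]
  rcases Nat.eq_zero_or_pos n with rfl | hn
  · simp [ha0]
  · rw [natCast_cpow_eq_phase (by omega)]

include hG

/-- The phase series is absolutely summable. [cite: ConreyIwaniec2002, §6 (6.4)] -/
theorem summable_norm_mul_phase (t : ℝ) : Summable fun n : ℕ => ‖a n * phase n t‖ := by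
  simpa [norm_mul, norm_phase] using summable_norm ha0 hG

/-- `|A(it)|² = Σ_{m,n} a_m m^{-it} · conj(a_n n^{-it})` (absolutely convergent double series).
[cite: ConreyIwaniec2002, §6 (6.4)] -/
theorem ofReal_norm_sq_LSeries (t : ℝ) :
    ((‖LSeries a (t * I)‖ ^ 2 : ℝ) : ℂ) =
      ∑' p : ℕ × ℕ, (a p.1 * phase p.1 t) * conj (a p.2 * phase p.2 t) := by
  rw [LSeries_eq_tsum_phase ha0, Complex.ofReal_pow, ← Complex.mul_conj', Complex.conj_tsum,
    tsum_mul_tsum_of_summable_norm (summable_norm_mul_phase ha0 hG t)]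
  simpa [norm_mul, norm_phase] using summable_norm ha0 hG

omit ha0 hG in
/-- The summand of the double series: `a_m m^{-it} conj(a_n n^{-it}) = a_m ā_n e^{-it(log m − log n)}`.
[cite: ConreyIwaniec2002, §6 (6.4)] -/
theorem phase_pair_eq (m n : ℕ) (t : ℝ) :
    (a m * phase m t) * conj (a n * phase n t) =
      a m * conj (a n) * Complex.exp ((-(t * (Real.log m - Real.log n)) : ℝ) * I) := by
  have h : phase m t * conj (phase n t) =
      Complex.exp ((-(t * (Real.log m - Real.log n)) : ℝ) * I) := by
    rw [phase, phase, ← Complex.exp_conj, map_mul, Complex.conj_ofReal, Complex.conj_I,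
      ← Complex.exp_add]
    congr 1
    push_cast
    ring
  rw [map_mul, ← h]
  ring

end Series

/-! ### The oscillatory integral `∫ K(t/T) e^{-itθ} dt = T·L(Tθ)` -/

section Kernel

variable {K : ℝ → ℝ} (hK : IsCIKernel K)
include hK

/-- **`∫ K(t/T) e^{-itθ} dt = T·L(Tθ)`** (substitution `t = Tu`, `𝓕K(ξ) = L(2πξ)`, `K` even).
[cite: ConreyIwaniec2002, §6 (6.2), (6.5)] -/
theorem integral_kernel_phase {T : ℝ} (hT : 0 < T) (θ : ℝ) :
    ∫ t : ℝ, (K (t / T) : ℂ) * Complex.exp ((-(t * θ) : ℝ) * I) = T * ciL K (T * θ) := by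
  have hsub := Measure.integral_comp_div
    (fun v : ℝ => (K v : ℂ) * Complex.exp ((-(T * v * θ) : ℝ) * I)) T
  beta_reduce at hsub
  have hlhs : ∀ x : ℝ, T * (x / T) * θ = x * θ := fun x => by field_simp
  simp_rw [hlhs] at hsub
  rw [hsub, abs_of_pos hT]
  have hF := fourier_kernel_eq hK (T * θ / (2 * Real.pi))
  rw [Real.fourier_real_eq_integral_exp_smul] at hF
  have hint : ∫ y : ℝ, (K y : ℂ) * Complex.exp ((-(T * y * θ) : ℝ) * I) =
      ∫ v : ℝ, Complex.exp (↑(-2 * Real.pi * v * (T * θ / (2 * Real.pi))) * I) •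
        ((K v : ℝ) : ℂ) := by
    refine integral_congr_ae (Eventually.of_forall fun v => ?_)
    have h : -2 * Real.pi * v * (T * θ / (2 * Real.pi)) = -(T * v * θ) := by field_simp
    simp only [smul_eq_mul, h]
    ring
  rw [hint, hF, show 2 * Real.pi * (T * θ / (2 * Real.pi)) = T * θ by field_simp,
    Complex.real_smul]

end Kernel

/-! ### The identity (6.5): `𝒜(T) = T Σ_{m,n} a_m ā_n L(T log(m/n))` -/

section Identity

variable {K : ℝ → ℝ} (hK : IsCIKernel K) {a : ℕ → ℂ} (ha0 : a 0 = 0)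
  (hG : Summable fun n : ℕ => (n : ℝ) ^ 2 * ‖a n‖ ^ 2) {T : ℝ} (hT : 0 < T)
include hK hT

/-- Termwise: `∫ K(t/T) a_m m^{-it} conj(a_n n^{-it}) dt = a_m ā_n · T·L(T(log m − log n))`.
[cite: ConreyIwaniec2002, §6 (6.4)–(6.5)] -/
theorem integral_kernel_pair (m n : ℕ) :
    ∫ t : ℝ, (K (t / T) : ℂ) * ((a m * phase m t) * conj (a n * phase n t)) =
      a m * conj (a n) * (T * ciL K (T * (Real.log m - Real.log n))) := by
  simp_rw [phase_pair_eq]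
  have : ∀ t : ℝ, (K (t / T) : ℂ) * (a m * conj (a n) *
      Complex.exp ((-(t * (Real.log m - Real.log n)) : ℝ) * I)) =
      a m * conj (a n) * ((K (t / T) : ℂ) *
        Complex.exp ((-(t * (Real.log m - Real.log n)) : ℝ) * I)) := fun t => by ring
  simp_rw [this, integral_const_mul, integral_kernel_phase hK hT]

include ha0 hG

/-- **(6.5), first form**: `∫ K(t/T)|Σ a_n n^{-it}|² dt = T Σ_{(m,n)} a_m ā_n L(T(log m − log n))`
(expand the square, integrate termwise — Fubini for the absolutely convergent double series
against the integrable `K(t/T)`). [cite: ConreyIwaniec2002, §6 (6.4)–(6.5)] -/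
theorem integral_kernel_normSq_eq :
    ((∫ t : ℝ, K (t / T) * ‖LSeries a (t * I)‖ ^ 2 : ℝ) : ℂ) =
      T * ∑' p : ℕ × ℕ,
        a p.1 * conj (a p.2) * (ciL K (T * (Real.log p.1 - Real.log p.2)) : ℂ) := by
  set Φ : ℕ × ℕ → ℝ → ℂ := fun p t =>
    (K (t / T) : ℂ) * ((a p.1 * phase p.1 t) * conj (a p.2 * phase p.2 t)) with hΦ
  have hKi : Integrable (fun t : ℝ => K (t / T)) :=
    (hK.1.integrable_of_hasCompactSupport hK.2.2.2.1).comp_div hT.ne'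
  have hnormΦ : ∀ (p : ℕ × ℕ) (t : ℝ), ‖Φ p t‖ = ‖a p.1‖ * ‖a p.2‖ * |K (t / T)| := by
    intro p t
    simp only [hΦ, norm_mul, Complex.norm_real, Real.norm_eq_abs, Complex.norm_conj, norm_phase,
      mul_one]
    ring
  have hint : ∀ p : ℕ × ℕ, Integrable (Φ p) := by
    intro p
    refine hKi.ofReal.mul_bdd (c := ‖a p.1‖ * ‖a p.2‖) ?_ (Eventually.of_forall fun t => ?_)
    · exact Continuous.aestronglyMeasurable (by
        have h1 := continuous_phase p.1
        have h2 := continuous_phase p.2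
        fun_prop)
    · simp only [norm_mul, Complex.norm_conj, norm_phase, mul_one]
      exact le_rfl
  have hsum : Summable fun p : ℕ × ℕ => ∫ t, ‖Φ p t‖ := by
    simp_rw [hnormΦ, integral_const_mul]
    exact ((summable_norm ha0 hG).mul_of_nonneg (summable_norm ha0 hG) (fun _ => norm_nonneg _)
      (fun _ => norm_nonneg _)).mul_right _
  calc ((∫ t : ℝ, K (t / T) * ‖LSeries a (t * I)‖ ^ 2 : ℝ) : ℂ)
      = ∫ t : ℝ, ((K (t / T) * ‖LSeries a (t * I)‖ ^ 2 : ℝ) : ℂ) := integral_complex_ofReal.symm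
    _ = ∫ t : ℝ, ∑' p : ℕ × ℕ, Φ p t := by
        refine integral_congr_ae (Eventually.of_forall fun t => ?_)
        simp only [hΦ]
        rw [Complex.ofReal_mul, ofReal_norm_sq_LSeries ha0 hG t, ← tsum_mul_left]
    _ = ∑' p : ℕ × ℕ, ∫ t, Φ p t := (integral_tsum_of_summable_integral_norm hint hsum).symm
    _ = ∑' p : ℕ × ℕ, a p.1 * conj (a p.2) *
          (T * ciL K (T * (Real.log p.1 - Real.log p.2))) :=
        tsum_congr fun p => integral_kernel_pair hK hT p.1 p.2
    _ = T * ∑' p : ℕ × ℕ,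
          a p.1 * conj (a p.2) * (ciL K (T * (Real.log p.1 - Real.log p.2)) : ℂ) := by
        rw [← tsum_mul_left]
        exact tsum_congr fun p => by ring

end Identity

/-! ### Splitting the double sum: diagonal, `m > n`, `m < n` -/

section Split

/-- A norm-summable double series over `ℕ × ℕ` splits into its diagonal, the part `m > n`
(parametrised by `m = n + h + 1`) and the part `m < n`. [cite: ConreyIwaniec2002, §6 (6.4)–(6.5)] -/
theorem tsum_prod_split (F : ℕ × ℕ → ℂ) (hF : Summable fun p => ‖F p‖) :
    ∑' p, F p = ∑' n : ℕ, F (n, n) + ∑' q : ℕ × ℕ, F (q.2 + q.1 + 1, q.2) +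
      ∑' q : ℕ × ℕ, F (q.2, q.2 + q.1 + 1) := by
  classical
  set Fd : ℕ × ℕ → ℂ := fun p => if p.1 = p.2 then F p else 0 with hFd
  set Fu : ℕ × ℕ → ℂ := fun p => if p.2 < p.1 then F p else 0 with hFu
  set Fl : ℕ × ℕ → ℂ := fun p => if p.1 < p.2 then F p else 0 with hFl
  have hsplit : ∀ p, F p = Fd p + Fu p + Fl p := by
    intro p
    rcases lt_trichotomy p.1 p.2 with h | h | h
    · simp [hFd, hFu, hFl, h, h.ne, not_lt.mpr h.le]
    · simp [hFd, hFu, hFl, h]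
    · simp [hFd, hFu, hFl, h, h.ne', not_lt.mpr h.le]
  have hbd : ∀ (c : Prop) [Decidable c] (p : ℕ × ℕ), ‖(if c then F p else 0)‖ ≤ ‖F p‖ := by
    intro c _ p
    split_ifs
    · exact le_rfl
    · rw [norm_zero]; exact norm_nonneg _
  have hsd : Summable Fd := Summable.of_norm_bounded hF fun p => hbd _ p
  have hsu : Summable Fu := Summable.of_norm_bounded hF fun p => hbd _ p
  have hsl : Summable Fl := Summable.of_norm_bounded hF fun p => hbd _ p
  rw [tsum_congr hsplit, (hsd.add hsu).tsum_add hsl, hsd.tsum_add hsu]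
  congr 1
  congr 1
  · have hinj : Function.Injective (fun n : ℕ => (n, n)) := fun a b h => (Prod.ext_iff.mp h).1
    have hsupp : Function.support Fd ⊆ Set.range (fun n : ℕ => (n, n)) := by
      intro p hp
      have h1 : p.1 = p.2 := by
        by_contra h
        exact hp (by simp [hFd, h])
      exact ⟨p.1, Prod.ext rfl h1⟩
    rw [← hinj.tsum_eq hsupp]
    exact tsum_congr fun n => by simp [hFd]
  · have hinj : Function.Injective (fun q : ℕ × ℕ => (q.2 + q.1 + 1, q.2)) := by
      intro q q' h
      simp only [Prod.mk.injEq] at h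
      ext <;> omega
    have hsupp : Function.support Fu ⊆ Set.range (fun q : ℕ × ℕ => (q.2 + q.1 + 1, q.2)) := by
      intro p hp
      have h1 : p.2 < p.1 := by
        by_contra h
        exact hp (by simp [hFu, h])
      exact ⟨(p.1 - p.2 - 1, p.2), Prod.ext (by dsimp only; omega) rfl⟩
    rw [← hinj.tsum_eq hsupp]
    exact tsum_congr fun q => by simp [hFu]
  · have hinj : Function.Injective (fun q : ℕ × ℕ => (q.2, q.2 + q.1 + 1)) := by
      intro q q' h
      simp only [Prod.mk.injEq] at h
      ext <;> omega
    have hsupp : Function.support Fl ⊆ Set.range (fun q : ℕ × ℕ => (q.2, q.2 + q.1 + 1)) := by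
      intro p hp
      have h1 : p.1 < p.2 := by
        by_contra h
        exact hp (by simp [hFl, h])
      exact ⟨(p.2 - p.1 - 1, p.1), Prod.ext rfl (by dsimp only; omega)⟩
    rw [← hinj.tsum_eq hsupp]
    exact tsum_congr fun q => by simp [hFl]

end Split

/-! ### (6.5): `𝒜(T) = L(0)TG + 2T Re Σ_{h>0} S(h)` -/

section MainIdentity

variable {K : ℝ → ℝ} (hK : IsCIKernel K) {a : ℕ → ℂ} (ha0 : a 0 = 0)
  (hG : Summable fun n : ℕ => (n : ℝ) ^ 2 * ‖a n‖ ^ 2) {T : ℝ} (hT : 0 < T)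

/-- The pair summand `F(m,n) = a_m ā_n L(T(log m − log n))` is Hermitian: `F(n,m) = conj F(m,n)`
(`L` real and even). [cite: ConreyIwaniec2002, §6 (6.4), "`S(−h) = \overline{S(h)}`"] -/
theorem pair_conj_symm (m n : ℕ) :
    a n * conj (a m) * (ciL K (T * (Real.log n - Real.log m)) : ℂ) =
      conj (a m * conj (a n) * (ciL K (T * (Real.log m - Real.log n)) : ℂ)) := by
  rw [map_mul, map_mul, Complex.conj_conj, Complex.conj_ofReal,
    show T * (Real.log n - Real.log m) = -(T * (Real.log m - Real.log n)) by ring, ciL_even]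
  ring

include ha0 hG in
/-- The pair family `(m,n) ↦ a_m ā_n L(T(log m − log n))` is norm-summable (`|L| ≤ 1`,
`Σ|a_n| < ∞`). [cite: ConreyIwaniec2002, §6 (6.3)–(6.5)] -/
theorem summable_norm_pair (hK : IsCIKernel K) :
    Summable fun p : ℕ × ℕ =>
      ‖a p.1 * conj (a p.2) * (ciL K (T * (Real.log p.1 - Real.log p.2)) : ℂ)‖ := by
  refine Summable.of_nonneg_of_le (fun _ => norm_nonneg _) (fun p => ?_)
    ((summable_norm ha0 hG).mul_of_nonneg (summable_norm ha0 hG) (fun _ => norm_nonneg _)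
      (fun _ => norm_nonneg _))
  rw [norm_mul, norm_mul, Complex.norm_conj, Complex.norm_real, Real.norm_eq_abs]
  have h1 : |ciL K (T * (Real.log p.1 - Real.log p.2))| ≤ 1 :=
    (abs_ciL_le hK _).trans (inv_le_one_of_one_le₀ (one_le_pow₀ (by
      have := abs_nonneg (T * (Real.log p.1 - Real.log p.2)); linarith)))
  calc ‖a p.1‖ * ‖a p.2‖ * |ciL K (T * (Real.log p.1 - Real.log p.2))|
      ≤ ‖a p.1‖ * ‖a p.2‖ * 1 := mul_le_mul_of_nonneg_left h1 (by positivity)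
    _ = ‖a p.1‖ * ‖a p.2‖ := mul_one _

include hK ha0 hG hT in
/-- **(6.5)**: `∫ K(t/T)|A(it)|² dt = L(0)·T·G + 2T·Re Σ_{h ≥ 1} Σ_{n ≥ 1} a_{n+h} ā_n L(T log((n+h)/n))`
with `G = Σ|a_n|²`; the double series over `(h', n') = (h−1, n−1) ∈ ℕ × ℕ`.
[cite: ConreyIwaniec2002, §6 (6.5)–(6.6)] -/
theorem integral_kernel_normSq_eq_diag_add_offdiag :
    ∫ t : ℝ, K (t / T) * ‖LSeries a (t * I)‖ ^ 2 =
      ciL K 0 * T * (∑' n : ℕ, ‖a n‖ ^ 2) +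
        2 * T * (∑' q : ℕ × ℕ, a (q.2 + 1 + (q.1 + 1)) * conj (a (q.2 + 1)) *
          (ciL K (T * (Real.log (q.2 + 1 + (q.1 + 1) : ℕ) - Real.log (q.2 + 1 : ℕ))) : ℂ)).re := by
  set F : ℕ × ℕ → ℂ := fun p =>
    a p.1 * conj (a p.2) * (ciL K (T * (Real.log p.1 - Real.log p.2)) : ℂ) with hFdef
  have hF : Summable fun p => ‖F p‖ := summable_norm_pair ha0 hG hK
  -- the upper off-diagonal sum, re-based at `n ≥ 1` (the terms `n = 0` vanish since `a 0 = 0`)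
  set U : ℂ := ∑' q : ℕ × ℕ, a (q.2 + 1 + (q.1 + 1)) * conj (a (q.2 + 1)) *
      (ciL K (T * (Real.log (q.2 + 1 + (q.1 + 1) : ℕ) - Real.log (q.2 + 1 : ℕ))) : ℂ) with hU
  have hupper : ∑' q : ℕ × ℕ, F (q.2 + q.1 + 1, q.2) = U := by
    -- drop the `q.2 = 0` slice (zero) : reindex `q.2 ↦ q.2 + 1` via injectivity
    have hinj : Function.Injective (fun q : ℕ × ℕ => (q.1, q.2 + 1)) := by
      intro q q' h
      simp only [Prod.mk.injEq] at h
      ext <;> omega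
    have hsupp : Function.support (fun q : ℕ × ℕ => F (q.2 + q.1 + 1, q.2)) ⊆
        Set.range (fun q : ℕ × ℕ => (q.1, q.2 + 1)) := by
      intro q hq
      have h2 : q.2 ≠ 0 := by
        rintro h
        exact hq (by simp [hFdef, h, ha0])
      exact ⟨(q.1, q.2 - 1), Prod.ext rfl (by dsimp only; omega)⟩
    rw [← hinj.tsum_eq hsupp, hU]
    refine tsum_congr fun q => ?_
    have e1 : q.2 + 1 + q.1 + 1 = q.2 + 1 + (q.1 + 1) := by omega
    simp only [hFdef, e1]
  have hlower : ∑' q : ℕ × ℕ, F (q.2, q.2 + q.1 + 1) = conj U := by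
    rw [← hupper, Complex.conj_tsum]
    exact tsum_congr fun q => pair_conj_symm _ _
  have hdiag : ∑' n : ℕ, F (n, n) = ((ciL K 0 * ∑' n : ℕ, ‖a n‖ ^ 2 : ℝ) : ℂ) := by
    rw [Complex.ofReal_mul, Complex.ofReal_tsum, ← tsum_mul_left]
    refine tsum_congr fun n => ?_
    simp only [hFdef, sub_self, mul_zero, Complex.mul_conj', Complex.ofReal_pow]
    ring
  have hmain := integral_kernel_normSq_eq hK ha0 hG hT
  rw [tsum_prod_split F hF, hupper, hlower, hdiag, add_assoc, Complex.add_conj] at hmain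
  have : ((∫ t : ℝ, K (t / T) * ‖LSeries a (t * I)‖ ^ 2 : ℝ) : ℂ) =
      ((ciL K 0 * T * (∑' n : ℕ, ‖a n‖ ^ 2) + 2 * T * U.re : ℝ) : ℂ) := by
    rw [hmain]; push_cast; ring
  exact_mod_cast this

end MainIdentity

end Thm61GenericPart

end ConreyIwaniec2002

end Literature.NumberTheory.LFunctions

end
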